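import Literature.Analysis.FluidPDE.NSHopfGalerkinExistence
import Literature.Topology.Euclidean.BrouwerAcuteAngle
import HarnessLib

/-!
# Stationary solutions of the Fourier–Galerkin systems of the Navier–Stokes equations on `T^d`

Trunk: FluidKinetic (`Literature/Analysis/FluidPDE`). First step of the existence proof of
steady weak solutions of the forced Navier–Stokes equations by the Galerkin method
(Temam, *Navier–Stokes Equations* (1977/79), Ch. II, §1, Thm. 1.2, proof, part (i), eqs.
(1.25)–(1.30): the finite-dimensional problems `ν((u_m, w_i)) + b(u_m, u_m, w_i) = ⟨f, w_i⟩`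
are solved by the acute angle lemma, Lemma 1.4, since
`[P_m(u), u] = ν‖u‖² − ⟨f, u⟩ ≥ ν‖u‖² − ‖f‖ ‖u‖ > 0` for `‖u‖` large, using `b(u, u, u) = 0`;
Constantin–Foias 1988, Ch. 8, (8.3)–(8.7) for the space-periodic Fourier–Galerkin system),
written for the tree's Fourier–Galerkin vector field `galerkinRHS S ν g` on the Galerkin phase
space `galerkinSubspace S` (`NSGalerkinFourier`: conjugate-symmetric transversal coefficient
vectors on a finite symmetric frequency set `S ⊆ ℤ^d`).

## Contents (all proved)

* `galerkin_energy_eq_of_galerkinRHS_eq_zero` — a zero `c` of the Galerkin field satisfies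
  the energy equation `ν ‖∇u‖² = ∫ ⟪G, u⟫` (`u = realTrigPoly S c̄`, `G = realTrigPoly S ḡ`;
  Temam (1.29) with `v = u_m`).
* `sum_freqNormSq_mul_norm_sq_le_of_galerkinRHS_eq_zero` — the a priori bound
  `(4π²ν)² ∑_{k∈S} |k|² ‖c k‖² ≤ ∑_{k∈S} ‖g k‖²` for such zeros when `0 ∉ S`
  (Temam (1.30): `‖u_m‖ ≤ ν⁻¹ ‖f‖_{V'}`; here `‖∇u‖² = 4π² ∑ |k|² ‖c k‖²` and
  `∫ ⟪G, u⟫ ≤ (∑ ‖g k‖²)^{1/2} (∑ ‖c k‖²)^{1/2} ≤ (∑ ‖g k‖²)^{1/2} ‖∇u‖ / (2π)`).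
* `exists_galerkinRHS_eq_zero` — **existence of stationary Galerkin solutions**: for `ν > 0`,
  a symmetric `S` not containing the mean mode `0`, and real force coefficients `g`, the
  Galerkin field has a zero in the Galerkin phase space (acute angle lemma
  `Brouwer.exists_zero_of_bilin_coercive` for the `ℓ²` form `∑_k Re ⟪c k, c' k⟫` and the
  energy identity `sum_re_inner_galerkinField_self`).

The mean mode is excluded because the Stokes term `-ν 4π²|k|² c k` provides no coercivity at
`k = 0`; for mean-zero forces the steady problem lives in the mean-zero space `H` anyway
(Temam, Ch. I, §1.4, (1.31)).

## Mathlib / tree search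

Tree: `galerkinRHS`, `galerkinSubspace`, `galerkinRHS_mem`, `sum_re_inner_galerkinField_self`
(`NSGalerkinFourier`), `continuous_galerkinRHS` (`NSHopfGalerkinExistence`),
`integral_inner_realTrigPoly_realTrigPoly`, `toReal_eGradNormSq_realTrigPoly`, `coeffExt`
(`TorusTrigPoly`); nothing on *stationary* Galerkin solutions (searched `stationary`,
`galerkinRHS .* = 0`). Mathlib: `Finset.sum_mul_sq_le_sq_mul_sq` (Cauchy–Schwarz),
`LinearMap.mk₂`.

## References

* R. Temam, *Navier–Stokes Equations. Theory and Numerical Analysis*, North-Holland (1977;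
  rev. ed. 1979), Ch. II, §1, Thm. 1.2 (proof, (1.25)–(1.30)) and Lemma 1.4. [Temam1979]
* P. Constantin, C. Foias, *Navier–Stokes Equations*, Univ. Chicago Press (1988), Ch. 8,
  (8.3)–(8.7). [ConstantinFoias1988]
-/

open MeasureTheory Set Filter UnitAddTorus
open scoped ENNReal NNReal InnerProductSpace

noncomputable section

namespace Literature.Analysis.FluidPDE

section NS

open FunctionSpaces.Torus Torus

variable {d : Type*} [Fintype d] [DecidableEq d] {S : Finset (d → ℤ)}

/-- For a real coefficient vector `c` in the Galerkin phase space, the sum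
`∑_{k} Re ⟪c k, V(c) k⟫` over the finite type `↥S` is the energy balance
`-ν ‖∇u‖² + ∫ ⟪G, u⟫` of `u = realTrigPoly S c̄` driven by `G = realTrigPoly S ḡ`
(`sum_re_inner_galerkinField_self` rewritten on `↥S`; Temam 1979, Ch. II (1.29)). [folklore] -/
theorem sum_re_inner_galerkinRHS_self (ν : ℝ) (hS : ∀ k ∈ S, -k ∈ S)
    {g c : ↥S → EuclideanSpace ℂ d} (hg : IsRealCoeff g) (hc : c ∈ galerkinSubspace S) :
    ∑ k : ↥S, (inner ℂ (c k) (galerkinRHS S ν g c k)).re =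
      -(ν * (eGradNormSq (realTrigPoly S (coeffExt S c))).toReal) +
        ∫ x, ⟪realTrigPoly S (coeffExt S g) x, realTrigPoly S (coeffExt S c) x⟫_ℝ := by
  have h := sum_re_inner_galerkinField_self ν hS (hg.isConjSymm_coeffExt hS)
    (hc.1.isConjSymm_coeffExt hS) hc.2.isTransversal_coeffExt
  rw [← h]
  exact (sum_coeffExt
    (fun k v => (inner ℂ v (galerkinField ν S (coeffExt S g) (coeffExt S c) k)).re) c).symm

/-- **Energy equation of a stationary Galerkin solution** (Temam 1979, Ch. II, (1.29) with
`v = u_m`): if `c` in the Galerkin phase space is a zero of the Galerkin field, then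
`ν ‖∇u‖² = ∫ ⟪G, u⟫` for `u = realTrigPoly S c̄`, `G = realTrigPoly S ḡ`.
[cite: Temam1979, Ch. II Thm. 1.2 (1.29)] -/
theorem galerkin_energy_eq_of_galerkinRHS_eq_zero (ν : ℝ) (hS : ∀ k ∈ S, -k ∈ S)
    {g c : ↥S → EuclideanSpace ℂ d} (hg : IsRealCoeff g) (hc : c ∈ galerkinSubspace S)
    (h0 : galerkinRHS S ν g c = 0) :
    ν * (eGradNormSq (realTrigPoly S (coeffExt S c))).toReal =
      ∫ x, ⟪realTrigPoly S (coeffExt S g) x, realTrigPoly S (coeffExt S c) x⟫_ℝ := by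
  have h := sum_re_inner_galerkinRHS_self ν hS hg hc
  rw [h0] at h
  simp only [Pi.zero_apply, inner_zero_right, Complex.zero_re, Finset.sum_const_zero] at h
  linarith

omit [DecidableEq d] in
/-- The pairing of the Galerkin force with the Galerkin field is controlled by the `ℓ²` norms
of the coefficients: `∫ ⟪G, u⟫ ≤ (∑ ‖g k‖²)^{1/2} (∑ ‖c k‖²)^{1/2}` (Parseval on `S` and the
Cauchy–Schwarz inequality; Temam 1979, Ch. II, proof of (1.30)). [folklore] -/
theorem integral_inner_realTrigPoly_coeffExt_le (hS : ∀ k ∈ S, -k ∈ S)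
    {g c : ↥S → EuclideanSpace ℂ d} (hg : IsRealCoeff g) (hc : IsRealCoeff c) :
    ∫ x, ⟪realTrigPoly S (coeffExt S g) x, realTrigPoly S (coeffExt S c) x⟫_ℝ ≤
      Real.sqrt (∑ k : ↥S, ‖g k‖ ^ 2) * Real.sqrt (∑ k : ↥S, ‖c k‖ ^ 2) := by
  rw [integral_inner_realTrigPoly_realTrigPoly hS (hg.isConjSymm_coeffExt hS)
    (hc.isConjSymm_coeffExt hS), ← Finset.sum_coe_sort]
  have h1 : ∑ k : ↥S, (inner ℂ (coeffExt S g k) (coeffExt S c k)).re ≤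
      ∑ k : ↥S, ‖g k‖ * ‖c k‖ := by
    refine Finset.sum_le_sum fun k _ => ?_
    rw [coeffExt_coe, coeffExt_coe]
    exact (Complex.re_le_norm _).trans (norm_inner_le_norm _ _)
  refine h1.trans ?_
  rw [← Real.sqrt_mul (Finset.sum_nonneg fun k _ => sq_nonneg _)]
  refine Real.le_sqrt_of_sq_le ?_
  exact Finset.sum_mul_sq_le_sq_mul_sq _ _ _

omit [DecidableEq d] in
/-- `∑ ‖c k‖² ≤ ∑ |k|² ‖c k‖²` on a frequency set not containing the mean mode (`|k|² ≥ 1`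
for `k ≠ 0`; the Poincaré inequality on the Galerkin space). [folklore] -/
theorem sum_norm_sq_le_sum_freqNormSq_mul (hS0 : (0 : d → ℤ) ∉ S)
    (c : ↥S → EuclideanSpace ℂ d) :
    ∑ k : ↥S, ‖c k‖ ^ 2 ≤ ∑ k : ↥S, freqNormSq (k : d → ℤ) * ‖c k‖ ^ 2 := by
  refine Finset.sum_le_sum fun k _ => ?_
  have hk : (k : d → ℤ) ≠ 0 := fun h => hS0 (h ▸ k.2)
  have h1 : (1 : ℝ) ≤ freqNormSq (k : d → ℤ) := by
    obtain ⟨i, hi⟩ : ∃ i, (k : d → ℤ) i ≠ 0 := Function.ne_iff.1 hk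
    have hi1 : (1 : ℝ) ≤ ((k : d → ℤ) i : ℝ) ^ 2 := by
      have h' : (1 : ℤ) ≤ ((k : d → ℤ) i) ^ 2 := by
        have := Int.one_le_abs hi
        nlinarith [sq_abs ((k : d → ℤ) i)]
      exact_mod_cast h'
    exact hi1.trans (Finset.single_le_sum (f := fun j => ((k : d → ℤ) j : ℝ) ^ 2)
      (fun j _ => sq_nonneg _) (Finset.mem_univ i))
  exact le_mul_of_one_le_left (sq_nonneg _) h1

/-- **A priori bound for stationary Galerkin solutions** (Temam 1979, Ch. II, (1.30):
`‖u_m‖ ≤ ν⁻¹ ‖f‖`): for a zero `c` of the Galerkin field on a symmetric `S ∌ 0`,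
`(4π²ν)² ∑_{k} |k|² ‖c k‖² ≤ ∑_{k} ‖g k‖²`. From the energy equation,
`ν ‖∇u‖² = ∫ ⟪G, u⟫ ≤ (∑ ‖g k‖²)^{1/2} (∑ ‖c k‖²)^{1/2}` and
`4π² ∑ ‖c k‖² ≤ ‖∇u‖² = 4π² ∑ |k|² ‖c k‖²`. [cite: Temam1979, Ch. II Thm. 1.2 (1.30)] -/
theorem sum_freqNormSq_mul_norm_sq_le_of_galerkinRHS_eq_zero {ν : ℝ} (hν : 0 < ν)
    (hS : ∀ k ∈ S, -k ∈ S) (hS0 : (0 : d → ℤ) ∉ S)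
    {g c : ↥S → EuclideanSpace ℂ d} (hg : IsRealCoeff g) (hc : c ∈ galerkinSubspace S)
    (h0 : galerkinRHS S ν g c = 0) :
    (4 * Real.pi ^ 2 * ν) ^ 2 * ∑ k : ↥S, freqNormSq (k : d → ℤ) * ‖c k‖ ^ 2 ≤
      ∑ k : ↥S, ‖g k‖ ^ 2 := by
  set E : ℝ := ∑ k : ↥S, freqNormSq (k : d → ℤ) * ‖c k‖ ^ 2 with hE
  set γ : ℝ := ∑ k : ↥S, ‖g k‖ ^ 2 with hγ
  set b : ℝ := ∑ k : ↥S, ‖c k‖ ^ 2 with hb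
  have hE0 : 0 ≤ E := Finset.sum_nonneg fun k _ => mul_nonneg (freqNormSq_nonneg _) (sq_nonneg _)
  have hγ0 : 0 ≤ γ := Finset.sum_nonneg fun k _ => sq_nonneg _
  have hb0 : 0 ≤ b := Finset.sum_nonneg fun k _ => sq_nonneg _
  have hbE : b ≤ E := sum_norm_sq_le_sum_freqNormSq_mul hS0 c
  have henergy := galerkin_energy_eq_of_galerkinRHS_eq_zero ν hS hg hc h0
  rw [toReal_eGradNormSq_realTrigPoly hS (hc.1.isConjSymm_coeffExt hS),
    sum_coeffExt (fun k v => freqNormSq k * ‖v‖ ^ 2)] at henergy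
  have hpair := integral_inner_realTrigPoly_coeffExt_le hS hg hc.1
  -- `ν 4π² E ≤ √γ √b ≤ √γ √E`
  have h1 : ν * (4 * Real.pi ^ 2 * E) ≤ Real.sqrt γ * Real.sqrt E := by
    rw [henergy]
    exact hpair.trans (mul_le_mul_of_nonneg_left (Real.sqrt_le_sqrt hbE) (Real.sqrt_nonneg _))
  -- square and cancel `E`
  by_cases hE' : E = 0
  · rw [hE', mul_zero]
    exact hγ0
  have hEpos : 0 < E := lt_of_le_of_ne hE0 (Ne.symm hE')
  have hsqE : 0 < Real.sqrt E := Real.sqrt_pos.2 hEpos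
  have h2 : ν * (4 * Real.pi ^ 2) * Real.sqrt E ≤ Real.sqrt γ := by
    have h3 : ν * (4 * Real.pi ^ 2) * Real.sqrt E * Real.sqrt E ≤ Real.sqrt γ * Real.sqrt E := by
      calc ν * (4 * Real.pi ^ 2) * Real.sqrt E * Real.sqrt E
          = ν * (4 * Real.pi ^ 2 * E) := by
            rw [mul_assoc, Real.mul_self_sqrt hE0]; ring
        _ ≤ Real.sqrt γ * Real.sqrt E := h1
    exact le_of_mul_le_mul_right h3 hsqE
  have h4 : 0 ≤ ν * (4 * Real.pi ^ 2) * Real.sqrt E := by positivity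
  have h5 := mul_self_le_mul_self h4 h2
  rw [Real.mul_self_sqrt hγ0] at h5
  calc (4 * Real.pi ^ 2 * ν) ^ 2 * E
      = ν * (4 * Real.pi ^ 2) * Real.sqrt E * (ν * (4 * Real.pi ^ 2) * Real.sqrt E) := by
        have : Real.sqrt E * Real.sqrt E = E := Real.mul_self_sqrt hE0
        calc (4 * Real.pi ^ 2 * ν) ^ 2 * E
            = (4 * Real.pi ^ 2 * ν) ^ 2 * (Real.sqrt E * Real.sqrt E) := by rw [this]
          _ = _ := by ring
    _ ≤ γ := h5

/-- **Existence of stationary Galerkin solutions** (Temam 1979, Ch. II, §1, proof of Thm. 1.2,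
part (i), via Lemma 1.4; Constantin–Foias 1988, Ch. 8, (8.3)–(8.7)). Let `ν > 0`, let
`S ⊆ ℤ^d` be a finite symmetric frequency set not containing the mean mode, and let `g` be a
real coefficient vector on `S` (the force). Then the Fourier–Galerkin vector field
`galerkinRHS S ν g` (`= -ν4π²|k|² c_k + Π_k(g_k − 𝓕[(u·∇)u](k))`) has a zero `c` in the
Galerkin phase space of real, transversal coefficient vectors: `u = realTrigPoly S c̄` is a
steady solution of the `S`-Galerkin approximation of the Navier–Stokes equations. Proof: the
acute angle lemma `Brouwer.exists_zero_of_bilin_coercive` on the Galerkin phase space with the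
`ℓ²` form `B(c, c') = ∑ Re ⟪c k, c' k⟫`, for which
`B(-V(c), c) = ν ‖∇u‖² − ∫ ⟪G, u⟫ ≥ 4π²ν B(c, c) − (∑ ‖g k‖²)^{1/2} B(c, c)^{1/2} ≥ 0` once
`B(c, c) ≥ (∑ ‖g k‖²)/(4π²ν)²`. [cite: Temam1979, Ch. II Thm. 1.2 (proof (i)), Lemma 1.4] -/
theorem exists_galerkinRHS_eq_zero {ν : ℝ} (hν : 0 < ν) (hS : ∀ k ∈ S, -k ∈ S)
    (hS0 : (0 : d → ℤ) ∉ S) {g : ↥S → EuclideanSpace ℂ d} (hg : IsRealCoeff g) :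
    ∃ c ∈ galerkinSubspace S, galerkinRHS S ν g c = 0 := by
  set Y := galerkinSubspace S with hY
  -- real scalars act on `ℂ^d` through the coercion `ℝ → ℂ`
  have hsmul : ∀ (a : ℝ) (x : EuclideanSpace ℂ d), a • x = (a : ℂ) • x := fun a x => by
    ext i
    simp only [PiLp.smul_apply, Complex.real_smul, smul_eq_mul]
  -- the `ℓ²` bilinear form on coefficient vectors, restricted to `Y`
  obtain ⟨B₀, hB₀⟩ : ∃ B₀ : (↥S → EuclideanSpace ℂ d) →ₗ[ℝ] (↥S → EuclideanSpace ℂ d) →ₗ[ℝ] ℝ,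
      ∀ c c', B₀ c c' = ∑ k : ↥S, (inner ℂ (c k) (c' k)).re :=
    ⟨LinearMap.mk₂ ℝ (fun c c' => ∑ k : ↥S, (inner ℂ (c k) (c' k)).re)
      (fun c₁ c₂ c' => by
        simp only [Pi.add_apply, inner_add_left, Complex.add_re, Finset.sum_add_distrib])
      (fun a c c' => by
        simp only [Pi.smul_apply, hsmul, inner_smul_left, Complex.conj_ofReal,
          Complex.re_ofReal_mul, Finset.mul_sum, smul_eq_mul])
      (fun c c₁ c₂ => by
        simp only [Pi.add_apply, inner_add_right, Complex.add_re, Finset.sum_add_distrib])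
      (fun a c c' => by
        simp only [Pi.smul_apply, hsmul, inner_smul_right, Complex.re_ofReal_mul,
          Finset.mul_sum, smul_eq_mul]),
      fun _ _ => rfl⟩
  obtain ⟨B, hB_apply⟩ : ∃ B : Y →ₗ[ℝ] Y →ₗ[ℝ] ℝ, ∀ c c' : Y, B c c' =
      ∑ k : ↥S, (inner ℂ ((c : ↥S → EuclideanSpace ℂ d) k) ((c' : ↥S → EuclideanSpace ℂ d) k)).re :=
    ⟨B₀.compl₁₂ Y.subtype Y.subtype, fun c c' => hB₀ _ _⟩
  have hB_self : ∀ c : Y, B c c = ∑ k : ↥S, ‖(c : ↥S → EuclideanSpace ℂ d) k‖ ^ 2 := by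
    intro c
    rw [hB_apply]
    refine Finset.sum_congr rfl fun k _ => ?_
    rw [← RCLike.re_to_complex, inner_self_eq_norm_sq]
  have hB_pos : ∀ c : Y, c ≠ 0 → 0 < B c c := by
    intro c hc
    rw [hB_self]
    have hc' : (c : ↥S → EuclideanSpace ℂ d) ≠ 0 := fun h => hc (Subtype.ext h)
    obtain ⟨k, hk⟩ : ∃ k, (c : ↥S → EuclideanSpace ℂ d) k ≠ 0 := Function.ne_iff.1 hc'
    exact lt_of_lt_of_le (pow_pos (norm_pos_iff.2 hk) 2)
      (Finset.single_le_sum (f := fun k => ‖(c : ↥S → EuclideanSpace ℂ d) k‖ ^ 2)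
        (fun k _ => sq_nonneg _) (Finset.mem_univ k))
  -- the field `-V` on the phase space
  obtain ⟨W, hWc, hW⟩ : ∃ W : Y → Y, Continuous W ∧
      ∀ c : Y, ((W c : Y) : ↥S → EuclideanSpace ℂ d) = -galerkinRHS S ν g c :=
    ⟨fun c => ⟨-galerkinRHS S ν g c, Y.neg_mem (galerkinRHS_mem ν hS hg c.2)⟩,
      Continuous.subtype_mk
        ((continuous_galerkinRHS ν).comp (continuous_const.prodMk continuous_subtype_val)).neg _,
      fun c => rfl⟩
  -- coercivity
  obtain ⟨γ, hγ⟩ : ∃ γ : ℝ, γ = ∑ k : ↥S, ‖g k‖ ^ 2 := ⟨_, rfl⟩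
  have hγ0 : 0 ≤ γ := by rw [hγ]; exact Finset.sum_nonneg fun k _ => sq_nonneg _
  have hden : 0 < 4 * Real.pi ^ 2 * ν := by positivity
  have hcoer : ∀ c : Y, γ / (4 * Real.pi ^ 2 * ν) ^ 2 ≤ B c c → 0 ≤ B (W c) c := by
    intro c hrc
    obtain ⟨b, hb⟩ : ∃ b : ℝ, b = ∑ k : ↥S, ‖(c : ↥S → EuclideanSpace ℂ d) k‖ ^ 2 := ⟨_, rfl⟩
    have hb0 : 0 ≤ b := by rw [hb]; exact Finset.sum_nonneg fun k _ => sq_nonneg _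
    rw [hB_self, ← hb] at hrc
    -- `B (W c) c = ν ‖∇u‖² - ∫ ⟪G, u⟫`
    have hWB : B (W c) c =
        ν * (eGradNormSq (realTrigPoly S (coeffExt S (c : ↥S → EuclideanSpace ℂ d)))).toReal -
          ∫ x, ⟪realTrigPoly S (coeffExt S g) x,
            realTrigPoly S (coeffExt S (c : ↥S → EuclideanSpace ℂ d)) x⟫_ℝ := by
      rw [hB_apply]
      have h1 : ∀ k : ↥S, (inner ℂ (((W c : Y) : ↥S → EuclideanSpace ℂ d) k)
          ((c : ↥S → EuclideanSpace ℂ d) k)).re =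
          -(inner ℂ ((c : ↥S → EuclideanSpace ℂ d) k) (galerkinRHS S ν g c k)).re := by
        intro k
        rw [← inner_conj_symm, Complex.conj_re, hW c, Pi.neg_apply, inner_neg_right, Complex.neg_re]
      simp only [h1, Finset.sum_neg_distrib, sum_re_inner_galerkinRHS_self ν hS hg c.2]
      ring
    rw [hWB, toReal_eGradNormSq_realTrigPoly hS (c.2.1.isConjSymm_coeffExt hS),
      sum_coeffExt (fun k v => freqNormSq k * ‖v‖ ^ 2)]
    have hpair := integral_inner_realTrigPoly_coeffExt_le hS hg c.2.1
    rw [← hγ, ← hb] at hpair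
    have hbE := sum_norm_sq_le_sum_freqNormSq_mul hS0 (c : ↥S → EuclideanSpace ℂ d)
    rw [← hb] at hbE
    -- `√γ √b ≤ 4π²ν b` since `γ/(4π²ν)² ≤ b`
    have h2 : γ ≤ (4 * Real.pi ^ 2 * ν) ^ 2 * b := by
      rw [div_le_iff₀ (by positivity)] at hrc
      linarith
    have h1 : Real.sqrt γ ≤ 4 * Real.pi ^ 2 * ν * Real.sqrt b := by
      calc Real.sqrt γ ≤ Real.sqrt ((4 * Real.pi ^ 2 * ν) ^ 2 * b) := Real.sqrt_le_sqrt h2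
        _ = 4 * Real.pi ^ 2 * ν * Real.sqrt b := by
          rw [Real.sqrt_mul (sq_nonneg _), Real.sqrt_sq hden.le]
    have hsqrt : Real.sqrt γ * Real.sqrt b ≤ ν * (4 * Real.pi ^ 2 * b) := by
      calc Real.sqrt γ * Real.sqrt b ≤ 4 * Real.pi ^ 2 * ν * Real.sqrt b * Real.sqrt b :=
            mul_le_mul_of_nonneg_right h1 (Real.sqrt_nonneg _)
        _ = ν * (4 * Real.pi ^ 2 * b) := by
            rw [mul_assoc, Real.mul_self_sqrt hb0]; ring
    have hE : ν * (4 * Real.pi ^ 2 * b) ≤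
        ν * (4 * Real.pi ^ 2 * ∑ k : ↥S, freqNormSq (k : d → ℤ) *
          ‖(c : ↥S → EuclideanSpace ℂ d) k‖ ^ 2) :=
      mul_le_mul_of_nonneg_left (mul_le_mul_of_nonneg_left hbE (by positivity)) hν.le
    linarith
  obtain ⟨c, hc⟩ :=
    Literature.Topology.Euclidean.Brouwer.exists_zero_of_bilin_coercive B hB_pos hWc hcoer
  refine ⟨c, c.2, ?_⟩
  have h := hW c
  rw [hc, Submodule.coe_zero] at h
  exact neg_eq_zero.1 h.symm

end NS

end Literature.Analysis.FluidPDE
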